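import Summits.NavierStokesRegularity.NavierStokesRegularity.Theorems.PerpetualPumpCircuitPumpClockBoxWindow

/-!
# `PerpetualPump.CircuitPump` (stmt-NavierStokesRegularity-1834), line `singular-clock-gspt`:
# choice of the seed `ε` of the Toda clock box

Sub-goal `toda_clockBox_eps` of `stub_clockBox` (Toda `m = 2` instance). For fixed `lam ∈ (1, 3/2]`
put `q = lam^{1/5} > 1`, `r = lam^{-4/5} < 1`; with `ε = e^{-Λ}` the amplitudes
`A⋆ = (q+1)Λ/(2(q-1))`, `A₁ = 0.9 A⋆ = κ₁ Λ`, `A₂ = 1.1 A⋆ = κ₂ Λ` are linear in `Λ`, and every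
largeness / smallness condition of the clock box is a statement `poly(Λ) e^{-cΛ} → 0`, `1/Λ → 0` or
`log Λ / Λ → 0`, uniformly in the box height `Tmax ∈ (0, 1/8]` (the landed window numerics
`toda_clockBox_window` give `0 < Tmax ≤ 1/8`). We prove each condition as an `∀ᶠ Λ in atTop` fact
(with `s = e^{-Λ/20}`, so that `ε = s^20` and all the real powers of `ε` that occur are natural powers
of `s`) and extract a witness. Pure real analysis. [folklore]
-/

set_option linter.dupNamespace false

noncomputable section

open Filter Topology

namespace Summit.NavierStokesRegularity.NavierStokesRegularity.Theorems.PerpetualPumpCircuitPump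

/-- `C Λ^k e^{-jΛ/20} ≤ c` for `Λ` large (`j ≥ 1`, `c > 0`). [folklore] -/
theorem clockBoxEps_powexp (C : ℝ) (k j : ℕ) (hj : 0 < j) {c : ℝ} (hc : 0 < c) :
    ∀ᶠ Λ in atTop, C * Λ ^ k * Real.exp (-Λ / 20) ^ j ≤ c := by
  have h := ((tendsto_rpow_mul_exp_neg_mul_atTop_nhds_zero k ((j : ℝ) / 20)
    (by positivity)).const_mul C)
  rw [mul_zero] at h
  refine (h.eventually (eventually_le_nhds hc)).mono fun Λ hΛ => ?_
  have e : Real.exp (-((j : ℝ) / 20) * Λ) = Real.exp (-Λ / 20) ^ j := by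
    rw [← Real.exp_nat_mul]; congr 1; ring
  rwa [Real.rpow_natCast, e, ← mul_assoc] at hΛ

/-- `C e^{-jΛ/20} ≤ c` for `Λ` large (`j ≥ 1`, `c > 0`). [folklore] -/
theorem clockBoxEps_exp (C : ℝ) (j : ℕ) (hj : 0 < j) {c : ℝ} (hc : 0 < c) :
    ∀ᶠ Λ in atTop, C * Real.exp (-Λ / 20) ^ j ≤ c := by
  refine (clockBoxEps_powexp C 0 j hj hc).mono fun Λ hΛ => ?_
  simpa only [pow_zero, mul_one] using hΛ

/-- `C / Λ ≤ c` for `Λ` large (`c > 0`). [folklore] -/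
theorem clockBoxEps_inv (C : ℝ) {c : ℝ} (hc : 0 < c) : ∀ᶠ Λ in atTop, C / Λ ≤ c :=
  (tendsto_const_nhds.div_atTop tendsto_id).eventually (eventually_le_nhds hc)

/-- **Largeness conditions.** With `A₁ = κ₁ Λ`, `A₂ = κ₂ Λ`, `ε = (e^{-Λ/20})^{20}`: for `Λ` large,
`40000 ≤ A₁`, `HBIG : 100000 (log A₂ + 500) ≤ Λ`, `ε ≤ 10⁻⁵` and `HS3 : A₂² ε^{3/20} ≤ 1/2`.
[folklore] -/
theorem clockBoxEps_large {κ₁ κ₂ : ℝ} (hκ₁ : 0 < κ₁) (hκ₂ : 0 < κ₂) :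
    ∀ᶠ Λ in atTop, 0 < Λ ∧ 40000 ≤ κ₁ * Λ ∧ 100000 * (Real.log (κ₂ * Λ) + 500) ≤ Λ ∧
      Real.exp (-Λ / 20) ^ 20 ≤ 1 / 100000 ∧ (κ₂ * Λ) ^ 2 * Real.exp (-Λ / 20) ^ 3 ≤ 1 / 2 := by
  filter_upwards [eventually_gt_atTop 0, eventually_ge_atTop (40000 / κ₁),
    Real.isLittleO_log_id_atTop.bound (show (0 : ℝ) < 1 / 200000 by norm_num),
    eventually_ge_atTop (2 * (100000 * Real.log κ₂ + 50000000)),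
    clockBoxEps_exp 1 20 (by norm_num) (show (0 : ℝ) < 1 / 100000 by norm_num),
    clockBoxEps_powexp (κ₂ ^ 2) 2 3 (by norm_num) (show (0 : ℝ) < 1 / 2 by norm_num)]
    with Λ h0 h1 h2 h3 h4 h5
  refine ⟨h0, ?_, ?_, ?_, ?_⟩
  · rw [div_le_iff₀ hκ₁] at h1; linarith
  · rw [Real.log_mul hκ₂.ne' h0.ne']
    simp only [id, Real.norm_eq_abs, abs_of_pos h0] at h2
    linarith [le_abs_self (Real.log Λ)]
  · simpa only [one_mul] using h4
  · calc (κ₂ * Λ) ^ 2 * Real.exp (-Λ / 20) ^ 3 = κ₂ ^ 2 * Λ ^ 2 * Real.exp (-Λ / 20) ^ 3 := by ring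
      _ ≤ 1 / 2 := h5

/-- **HS2**, uniformly in the box height `T ∈ (0, 1/8]`. [folklore] -/
theorem clockBoxEps_hs2 {q : ℝ} (κ₁ : ℝ) (hq : 0 < q) :
    ∀ᶠ Λ in atTop, ∀ T : ℝ, 0 < T → T ≤ 1 / 8 →
      (40 * q / (κ₁ * Λ) + 4 * Real.exp (-Λ / 20) ^ 20 * 169 * q * T) * Real.exp (65 * T) ≤
        1 / 2 := by
  obtain ⟨δ, hδ⟩ : ∃ δ : ℝ, δ = 1 / (4 * Real.exp (65 / 8)) := ⟨_, rfl⟩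
  have hδ0 : 0 < δ := by rw [hδ]; positivity
  filter_upwards [eventually_gt_atTop 0, clockBoxEps_inv (40 * q / κ₁) hδ0,
    clockBoxEps_exp (4 * 169 * q / 8) 20 (by norm_num) hδ0] with Λ h0 h1 h2 T hT0 hT8
  have ha : 40 * q / (κ₁ * Λ) ≤ δ := by rwa [div_div] at h1
  have hb : 4 * Real.exp (-Λ / 20) ^ 20 * 169 * q * T ≤ δ := by
    calc 4 * Real.exp (-Λ / 20) ^ 20 * 169 * q * T
          ≤ 4 * Real.exp (-Λ / 20) ^ 20 * 169 * q * (1 / 8) :=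
          mul_le_mul_of_nonneg_left hT8 (by positivity)
      _ = 4 * 169 * q / 8 * Real.exp (-Λ / 20) ^ 20 := by ring
      _ ≤ δ := h2
  have hE : Real.exp (65 * T) ≤ Real.exp (65 / 8) := Real.exp_le_exp.2 (by linarith)
  calc (40 * q / (κ₁ * Λ) + 4 * Real.exp (-Λ / 20) ^ 20 * 169 * q * T) * Real.exp (65 * T)
        ≤ (δ + δ) * Real.exp (65 / 8) :=
        mul_le_mul (add_le_add ha hb) hE (by positivity) (by positivity)
    _ = 1 / 2 := by rw [hδ]; field_simp; norm_num

/-- The trail seed bound `σb ≤ (40/κ₁) e^{(66/8)/(1-r)} / Λ` once `16.9 ε A₁ ≤ 1` and `T ≤ 1/8`.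
[folklore] -/
theorem clockBoxEps_sigma {κ₁ r Λ s T : ℝ} (hκ₁ : 0 < κ₁) (hr : r < 1) (h0 : 0 < Λ)
    (hx : 169 / 10 * κ₁ * Λ ^ 1 * s ^ 20 ≤ 1) (hT0 : 0 < T) (hT8 : T ≤ 1 / 8) :
    40 / (κ₁ * Λ) * Real.exp ((65 + 169 / 10 * s ^ 20 * (κ₁ * Λ)) * T / (1 - r)) ≤
      40 / κ₁ * Real.exp (66 / 8 / (1 - r)) / Λ := by
  have h1r : 0 < 1 - r := by linarith
  have hx0 : 0 ≤ 169 / 10 * s ^ 20 * (κ₁ * Λ) := by positivity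
  have hx1 : 169 / 10 * s ^ 20 * (κ₁ * Λ) ≤ 1 := by rw [pow_one] at hx; linarith
  have hnum : (65 + 169 / 10 * s ^ 20 * (κ₁ * Λ)) * T ≤ 66 / 8 := by
    nlinarith [mul_le_mul_of_nonneg_right hx1 hT0.le]
  have hexp : (65 + 169 / 10 * s ^ 20 * (κ₁ * Λ)) * T / (1 - r) ≤ 66 / 8 / (1 - r) :=
    div_le_div_of_nonneg_right hnum h1r.le
  calc 40 / (κ₁ * Λ) * Real.exp ((65 + 169 / 10 * s ^ 20 * (κ₁ * Λ)) * T / (1 - r))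
        ≤ 40 / (κ₁ * Λ) * Real.exp (66 / 8 / (1 - r)) :=
        mul_le_mul_of_nonneg_left (Real.exp_le_exp.2 hexp) (by positivity)
    _ = 40 / κ₁ * Real.exp (66 / 8 / (1 - r)) / Λ := by ring

/-- **HSσ** (`σb ≤ 10⁻³`), uniformly in `T ∈ (0, 1/8]`. [folklore] -/
theorem clockBoxEps_hsσ {κ₁ r : ℝ} (hκ₁ : 0 < κ₁) (hr : r < 1) :
    ∀ᶠ Λ in atTop, ∀ T : ℝ, 0 < T → T ≤ 1 / 8 →
      40 / (κ₁ * Λ) * Real.exp ((65 + 169 / 10 * Real.exp (-Λ / 20) ^ 20 * (κ₁ * Λ)) * T / (1 - r)) ≤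
        1 / 1000 := by
  filter_upwards [eventually_gt_atTop 0,
    clockBoxEps_powexp (169 / 10 * κ₁) 1 20 (by norm_num) one_pos,
    clockBoxEps_inv (40 / κ₁ * Real.exp (66 / 8 / (1 - r))) (show (0 : ℝ) < 1 / 1000 by norm_num)]
    with Λ h0 h1 h2 T hT0 hT8
  exact (clockBoxEps_sigma hκ₁ hr h0 h1 hT0 hT8).trans h2

/-- **HS5** (trail slaving smallness), uniformly in `T ∈ (0, 1/8]`; the right-hand side
`13 (1 - r) > 0` is a fixed constant while the left-hand side is `O(1/Λ²)`. [folklore] -/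
theorem clockBoxEps_hs5 {κ₁ r : ℝ} (hκ₁ : 0 < κ₁) (hr : r < 1) :
    ∀ᶠ Λ in atTop, ∀ T : ℝ, 0 < T → T ≤ 1 / 8 →
      2 * (40 / (κ₁ * Λ) * Real.exp ((65 + 169 / 10 * Real.exp (-Λ / 20) ^ 20 * (κ₁ * Λ)) * T /
        (1 - r)) + 4 * Real.exp (-Λ / 20) ^ 20 * 169 * T) ^ 2 * Real.exp (130 * T) * T ≤
        13 * (1 - r) := by
  have h1r : 0 < 1 - r := by linarith
  obtain ⟨δ, hδ⟩ : ∃ δ : ℝ, δ = Real.sqrt (13 * (1 - r) / Real.exp (130 / 8)) := ⟨_, rfl⟩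
  have hδ0 : 0 < δ := by rw [hδ]; exact Real.sqrt_pos.2 (by positivity)
  have hδ2 : δ ^ 2 * Real.exp (130 / 8) = 13 * (1 - r) := by
    rw [hδ, Real.sq_sqrt (by positivity)]; field_simp
  filter_upwards [eventually_gt_atTop 0,
    clockBoxEps_powexp (169 / 10 * κ₁) 1 20 (by norm_num) one_pos,
    clockBoxEps_inv (40 / κ₁ * Real.exp (66 / 8 / (1 - r))) hδ0,
    clockBoxEps_exp (4 * 169 / 8) 20 (by norm_num) hδ0] with Λ h0 h1 h2 h3 T hT0 hT8
  have ha := (clockBoxEps_sigma hκ₁ hr h0 h1 hT0 hT8).trans h2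
  have hb : 4 * Real.exp (-Λ / 20) ^ 20 * 169 * T ≤ δ := by
    calc 4 * Real.exp (-Λ / 20) ^ 20 * 169 * T ≤ 4 * Real.exp (-Λ / 20) ^ 20 * 169 * (1 / 8) :=
          mul_le_mul_of_nonneg_left hT8 (by positivity)
      _ = 4 * 169 / 8 * Real.exp (-Λ / 20) ^ 20 := by ring
      _ ≤ δ := h3
  obtain ⟨S, hS⟩ : ∃ S : ℝ, S = 40 / (κ₁ * Λ) * Real.exp ((65 + 169 / 10 * Real.exp (-Λ / 20) ^ 20 *
    (κ₁ * Λ)) * T / (1 - r)) + 4 * Real.exp (-Λ / 20) ^ 20 * 169 * T := ⟨_, rfl⟩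
  rw [← hS]
  have hS0 : 0 ≤ S := by rw [hS]; positivity
  have hS2 : S ≤ 2 * δ := by rw [hS]; linarith
  have hsq : S ^ 2 ≤ (2 * δ) ^ 2 := pow_le_pow_left₀ hS0 hS2 2
  have hE : Real.exp (130 * T) ≤ Real.exp (130 / 8) := Real.exp_le_exp.2 (by linarith)
  calc 2 * S ^ 2 * Real.exp (130 * T) * T ≤ 2 * (2 * δ) ^ 2 * Real.exp (130 / 8) * (1 / 8) :=
        mul_le_mul (mul_le_mul (mul_le_mul_of_nonneg_left hsq (by norm_num)) hE (by positivity)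
          (by positivity)) hT8 hT0.le (by positivity)
    _ = δ ^ 2 * Real.exp (130 / 8) := by ring
    _ = 13 * (1 - r) := hδ2

/-- **HS6** (precursor carrier budget), uniformly in `T ∈ (0, 1/8]`. [folklore] -/
theorem clockBoxEps_hs6 {lam q : ℝ} (κ₂ : ℝ) (hlam : 0 < lam) (hq : 0 < q) :
    ∀ᶠ Λ in atTop, ∀ T : ℝ, 0 < T → T ≤ 1 / 8 →
      q * ((Real.exp (-Λ / 20) ^ 20) ^ 2 / (4 * lam ^ 2) +
        lam * (Real.exp (-Λ / 20) ^ 9 * (κ₂ * Λ) ^ 28 * Real.exp 548) ^ 2 * T +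
        28 * (Real.exp (-Λ / 20) ^ 20) ^ 3 * T) ≤ Real.exp (-Λ / 20) ^ 15 := by
  filter_upwards [clockBoxEps_exp (q / (4 * lam ^ 2)) 25 (by norm_num) (show (0 : ℝ) < 1 / 3 by norm_num),
    clockBoxEps_powexp (q * lam * κ₂ ^ 56 * Real.exp 548 ^ 2 / 8) 56 3 (by norm_num)
      (show (0 : ℝ) < 1 / 3 by norm_num),
    clockBoxEps_exp (28 * q / 8) 45 (by norm_num) (show (0 : ℝ) < 1 / 3 by norm_num)]
    with Λ h1 h2 h3 T hT0 hT8
  set s := Real.exp (-Λ / 20) with hs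
  have hs0 : 0 < s := Real.exp_pos _
  calc q * ((s ^ 20) ^ 2 / (4 * lam ^ 2) + lam * (s ^ 9 * (κ₂ * Λ) ^ 28 * Real.exp 548) ^ 2 * T +
        28 * (s ^ 20) ^ 3 * T)
      ≤ q * ((s ^ 20) ^ 2 / (4 * lam ^ 2) + lam * (s ^ 9 * (κ₂ * Λ) ^ 28 * Real.exp 548) ^ 2 * (1 / 8) +
        28 * (s ^ 20) ^ 3 * (1 / 8)) := by gcongr
    _ = s ^ 15 * (q / (4 * lam ^ 2) * s ^ 25 +
        q * lam * κ₂ ^ 56 * Real.exp 548 ^ 2 / 8 * Λ ^ 56 * s ^ 3 + 28 * q / 8 * s ^ 45) := by ring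
    _ ≤ s ^ 15 * (1 / 3 + 1 / 3 + 1 / 3) := by gcongr
    _ = s ^ 15 := by ring

/-- **HS7** (precursor bond budget), uniformly in `T ∈ (0, 1/8]`. [folklore] -/
theorem clockBoxEps_hs7 {lam : ℝ} (κ₂ : ℝ) (hlam : 0 < lam) :
    ∀ᶠ Λ in atTop, ∀ T : ℝ, 0 < T → T ≤ 1 / 8 →
      18 * Real.exp (-Λ / 20) ^ 20 * ((Real.exp (-Λ / 20) ^ 20) ^ 2 +
        4 * lam ^ 3 * (Real.exp (-Λ / 20) ^ 9 * (κ₂ * Λ) ^ 28 * Real.exp 548) ^ 2 * T) ^ 2 ≤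
        Real.exp (-Λ / 20) ^ 30 := by
  filter_upwards [clockBoxEps_exp 36 70 (by norm_num) (show (0 : ℝ) < 1 / 2 by norm_num),
    clockBoxEps_powexp (36 * (lam ^ 3 * κ₂ ^ 56 * Real.exp 548 ^ 2 / 2) ^ 2) 112 26 (by norm_num)
      (show (0 : ℝ) < 1 / 2 by norm_num)] with Λ h1 h2 T hT0 hT8
  set s := Real.exp (-Λ / 20) with hs
  have hs0 : 0 < s := Real.exp_pos _
  set K := lam ^ 3 * κ₂ ^ 56 * Real.exp 548 ^ 2 / 2 with hK
  obtain ⟨X, hX⟩ : ∃ X : ℝ, X = 4 * lam ^ 3 * (s ^ 9 * (κ₂ * Λ) ^ 28 * Real.exp 548) ^ 2 * T :=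
    ⟨_, rfl⟩
  rw [← hX]
  have hX0 : 0 ≤ X := by rw [hX]; positivity
  have hXle : X ≤ K * Λ ^ 56 * s ^ 18 := by
    rw [hX]
    calc 4 * lam ^ 3 * (s ^ 9 * (κ₂ * Λ) ^ 28 * Real.exp 548) ^ 2 * T
        ≤ 4 * lam ^ 3 * (s ^ 9 * (κ₂ * Λ) ^ 28 * Real.exp 548) ^ 2 * (1 / 8) :=
          mul_le_mul_of_nonneg_left hT8 (by positivity)
      _ = K * Λ ^ 56 * s ^ 18 := by rw [hK]; ring
  have hsq : ((s ^ 20) ^ 2 + X) ^ 2 ≤ 2 * ((s ^ 20) ^ 2) ^ 2 + 2 * (K * Λ ^ 56 * s ^ 18) ^ 2 := by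
    nlinarith [sq_nonneg ((s ^ 20) ^ 2 - X), pow_le_pow_left₀ hX0 hXle 2]
  calc 18 * s ^ 20 * ((s ^ 20) ^ 2 + X) ^ 2
      ≤ 18 * s ^ 20 * (2 * ((s ^ 20) ^ 2) ^ 2 + 2 * (K * Λ ^ 56 * s ^ 18) ^ 2) :=
        mul_le_mul_of_nonneg_left hsq (by positivity)
    _ = s ^ 30 * (36 * s ^ 70 + 36 * K ^ 2 * Λ ^ 112 * s ^ 26) := by ring
    _ ≤ s ^ 30 * (1 / 2 + 1 / 2) := by gcongr
    _ = s ^ 30 := by ring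

/-- **CHOICE OF ε.** For every `lam ∈ (1, 3/2]` there is a seed `ε = e^{−Λ}` meeting every largeness /
smallness condition of the clock box (all are `poly(Λ)·e^{−cΛ} → 0` or `log Λ / Λ → 0` statements). -/
theorem toda_clockBox_eps :
    ∀ (lam : ℝ), 1 < lam → lam ≤ 3 / 2 → ∃ (ν q r ε Λ As A₁ A₂ Tmax : ℝ),
      ν = lam ^ (4 / 5 : ℝ) ∧ q = lam ^ (1 / 5 : ℝ) ∧ r = lam ^ (-(4 / 5 : ℝ)) ∧ 0 < ε ∧ Λ = -Real.log ε ∧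
      As = (q + 1) * Λ / (2 * (q - 1)) ∧ A₁ = 9 / 10 * As ∧ A₂ = 11 / 10 * As ∧ 40000 ≤ A₁ ∧
      100000 * (Real.log A₂ + 500) ≤ Λ ∧
      Tmax = (-Real.log (1 - (((Λ) / 2 + Real.log (A₂ / 8)) + 11 / 5) / A₁) + (250 + 16 * Real.log A₂) / A₁ + (-(1 / ν) * Real.log (1 - ν * ((Λ) / 2 - Real.log q + 73) / (lam * (A₁ - ((Λ) / 2 + Real.log (A₁ / 8)) - 903 - 50 * Real.log A₁))))) ∧
      ε ≤ 1 / 100000 ∧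
      (40 * q / A₁ + 4 * ε * 169 * q * Tmax) * Real.exp (65 * Tmax) ≤ 1 / 2 ∧
      A₂ ^ 2 * ε ^ (3 / 20 : ℝ) ≤ 1 / 2 ∧
      2 * (40 / A₁ * Real.exp ((65 + 169 / 10 * ε * A₁) * Tmax / (1 - r)) + 4 * ε * 169 * Tmax) ^ 2 *
        Real.exp (130 * Tmax) * Tmax ≤ 13 * (1 - r) ∧
      40 / A₁ * Real.exp ((65 + 169 / 10 * ε * A₁) * Tmax / (1 - r)) ≤ 1 / 1000 ∧
      q * (ε ^ 2 / (4 * lam ^ 2) + lam * (ε ^ (9 / 20 : ℝ) * A₂ ^ 28 * Real.exp 548) ^ 2 * Tmax + 28 * ε ^ 3 * Tmax) ≤ ε ^ (3 / 4 : ℝ) ∧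
      18 * ε * (ε ^ 2 + 4 * lam ^ 3 * (ε ^ (9 / 20 : ℝ) * A₂ ^ 28 * Real.exp 548) ^ 2 * Tmax) ^ 2 ≤ ε ^ (3 / 2 : ℝ) := by
  intro lam hlam hlam2
  have hlam0 : 0 < lam := lt_trans one_pos hlam
  obtain ⟨ν, hν⟩ : ∃ ν : ℝ, ν = lam ^ (4 / 5 : ℝ) := ⟨_, rfl⟩
  obtain ⟨q, hq⟩ : ∃ q : ℝ, q = lam ^ (1 / 5 : ℝ) := ⟨_, rfl⟩
  obtain ⟨r, hr⟩ : ∃ r : ℝ, r = lam ^ (-(4 / 5 : ℝ)) := ⟨_, rfl⟩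
  have hq1 : 1 < q := by rw [hq]; exact Real.one_lt_rpow hlam (by norm_num)
  have hq0 : 0 < q := one_pos.trans hq1
  have hq1' : 0 < q - 1 := sub_pos.2 hq1
  have hr1 : r < 1 := by rw [hr]; exact Real.rpow_lt_one_of_one_lt_of_neg hlam (by norm_num)
  obtain ⟨κ₁, hκ₁⟩ : ∃ κ₁ : ℝ, κ₁ = 9 / 10 * ((q + 1) / (2 * (q - 1))) := ⟨_, rfl⟩
  obtain ⟨κ₂, hκ₂⟩ : ∃ κ₂ : ℝ, κ₂ = 11 / 10 * ((q + 1) / (2 * (q - 1))) := ⟨_, rfl⟩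
  have hκ₁0 : 0 < κ₁ := by rw [hκ₁]; positivity
  have hκ₂0 : 0 < κ₂ := by rw [hκ₂]; positivity
  obtain ⟨Λ, ⟨hΛ0, h40000, HBIG, hε5, hS3⟩, hS2, hS5, hSσ, hS6, hS7⟩ :=
    ((clockBoxEps_large hκ₁0 hκ₂0).and ((clockBoxEps_hs2 κ₁ hq0).and
      ((clockBoxEps_hs5 hκ₁0 hr1).and ((clockBoxEps_hsσ hκ₁0 hr1).and
        ((clockBoxEps_hs6 κ₂ hlam0 hq0).and (clockBoxEps_hs7 κ₂ hlam0)))))).exists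
  obtain ⟨ε, hε⟩ : ∃ ε : ℝ, ε = Real.exp (-Λ / 20) ^ 20 := ⟨_, rfl⟩
  have hε0 : 0 < ε := by rw [hε]; positivity
  have hΛ : Λ = -Real.log ε := by rw [hε, Real.log_pow, Real.log_exp]; push_cast; ring
  have hs0 := (Real.exp_pos (-Λ / 20)).le
  have he3 : Real.exp (-Λ / 20) ^ 3 = ε ^ (3 / 20 : ℝ) := by
    rw [hε, ← Real.rpow_natCast _ 20, ← Real.rpow_mul hs0, ← Real.rpow_natCast _ 3]; norm_num
  have he9 : Real.exp (-Λ / 20) ^ 9 = ε ^ (9 / 20 : ℝ) := by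
    rw [hε, ← Real.rpow_natCast _ 20, ← Real.rpow_mul hs0, ← Real.rpow_natCast _ 9]; norm_num
  have he15 : Real.exp (-Λ / 20) ^ 15 = ε ^ (3 / 4 : ℝ) := by
    rw [hε, ← Real.rpow_natCast _ 20, ← Real.rpow_mul hs0, ← Real.rpow_natCast _ 15]; norm_num
  have he30 : Real.exp (-Λ / 20) ^ 30 = ε ^ (3 / 2 : ℝ) := by
    rw [hε, ← Real.rpow_natCast _ 20, ← Real.rpow_mul hs0, ← Real.rpow_natCast _ 30]; norm_num
  obtain ⟨As, hAs⟩ : ∃ As : ℝ, As = (q + 1) * Λ / (2 * (q - 1)) := ⟨_, rfl⟩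
  obtain ⟨A₁, hA₁⟩ : ∃ A₁ : ℝ, A₁ = 9 / 10 * As := ⟨_, rfl⟩
  obtain ⟨A₂, hA₂⟩ : ∃ A₂ : ℝ, A₂ = 11 / 10 * As := ⟨_, rfl⟩
  have e₁ : κ₁ * Λ = A₁ := by rw [hκ₁, hA₁, hAs]; ring
  have e₂ : κ₂ * Λ = A₂ := by rw [hκ₂, hA₂, hAs]; ring
  rw [e₁] at h40000
  rw [e₂] at HBIG
  rw [e₂, he3] at hS3
  rw [← hε] at hε5
  rw [e₁, ← hε] at hS2 hS5 hSσ
  rw [e₂, ← hε, he9, he15] at hS6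
  rw [e₂, ← hε, he9, he30] at hS7
  obtain ⟨Tmax, hTm⟩ : ∃ Tmax : ℝ, Tmax = (-Real.log (1 - (((Λ) / 2 + Real.log (A₂ / 8)) + 11 / 5) / A₁) + (250 + 16 * Real.log A₂) / A₁ + (-(1 / ν) * Real.log (1 - ν * ((Λ) / 2 - Real.log q + 73) / (lam * (A₁ - ((Λ) / 2 + Real.log (A₁ / 8)) - 903 - 50 * Real.log A₁))))) := ⟨_, rfl⟩
  obtain ⟨-, h250, hT8, hwin, -⟩ :=
    toda_clockBox_window lam ν q ε Λ As A₁ A₂ hlam hlam2 hν hq hε0 hΛ hAs hA₁ hA₂ h40000 HBIG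
  rw [← hTm] at hT8 hwin
  have hA₁₂ : A₁ ≤ A₂ := by
    have : 0 ≤ As := by rw [hAs]; positivity
    rw [hA₁, hA₂]; linarith
  obtain ⟨hw1, hw2, hw3⟩ := hwin A₁ ⟨le_rfl, hA₁₂⟩
  have hT0 : 0 < Tmax := by linarith
  exact ⟨ν, q, r, ε, Λ, As, A₁, A₂, Tmax, hν, hq, hr, hε0, hΛ, hAs, hA₁, hA₂, h40000, HBIG, hTm, hε5,
    hS2 Tmax hT0 hT8, hS3, hS5 Tmax hT0 hT8, hSσ Tmax hT0 hT8, hS6 Tmax hT0 hT8, hS7 Tmax hT0 hT8⟩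

end Summit.NavierStokesRegularity.NavierStokesRegularity.Theorems.PerpetualPumpCircuitPump
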